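import Summits.BirchSwinnertonDyer.BirchSwinnertonDyer.Theorems.AdditiveKolyvaginRoadLevelSystemsRigidityDichotomy
import HarnessLib

/-!
# Route `AdditiveKolyvaginRoad`, crux `LevelKolyvaginSystemsAdditive` (item stmt-BirchSwinnertonDyer-21396, KS′):
# CANONICAL LINES in the CONDUCTOR direction — the twin dichotomy at Kolyvagin primes, abstract
# (cell `pub/bsd-wall`, width seat `bsd-wall-akr-p2x-w3` g7; `--supports stmt-BirchSwinnertonDyer-21396`, helper; conductor-direction
# companion of w2's level-direction engine `…LevelSystemsRigidityDichotomy`)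

WHY. The crux's structure `LevelKolyvaginSystemP W K p Dt β ι c` DECOUPLES (crux-triage seat 1, v17 §1): its level-`∅` row is the
frame's actual Kolyvagin classes (constrained only by `transport` at `n = ∅`, i.e. by ONE non-zero class — a SEED); every row at a
non-empty level `n` is a statement about the MIXED spaces `S(m, n)^μ ⊂ H¹(K, E[p])` (Kummer off `m ∪ n`, TORIC on `n`, TRANSVERSE on
`m`, sign `μ`). Abstract half: over a field, for `S : Finset L → Bool → Submodule F H` (the mixed spaces at ONE fixed level, indexed by
the conductor `m` and the sign) and «vanishing above `ℓ`» subspaces `Z : L → Submodule F H`, the CANONICAL LINES — a generator of the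
line when the total rank `dim S(m)⁺ + dim S(m)⁻` is `1`, else `0` — satisfy the crux's conductor-direction rows GIVEN the TWIN
DICHOTOMY at a new Kolyvagin prime `ℓ ∉ m` in EACH sign: (Z) `S(mℓ)^μ ⊓ Z ℓ = S(m)^μ ⊓ Z ℓ`; (Det) a `μ`-class of `S(m)` detected
above `ℓ` ⟹ `S(mℓ)^μ ≤ Z ℓ` (reciprocity + perfectness `H¹_f^μ × H¹_tr^μ → 𝔽_p`); (Jump) `S(m)^μ ≤ Z ℓ` ⟹ some `μ`-class of `S(mℓ)`
is off `Z ℓ` (Poitou–Tate jump + the local axis lemma); (Line) line-rigidity above `ℓ`. These are Howard's (H.0)–(H.5) ∕ Mazur–Rubin's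
Lemma 4.1.7 over `𝔽_p` with complex conjugation, in BOTH signs at once (a Kolyvagin prime flips both sign-parities).

WHAT. §1 codimension one from line-rigidity; §2 the ranks: detected `−1`, undetected `+1`, sign parity `dim S(m)^μ ≡ dim S(∅)^μ + #m`,
total parity constant; §3 cores (total rank one) and `exists_canonicalLines`; §4 THE RELATION (8.1) for canonical lines
(`mem_iff_mem_of_canonicalLines`); §5 CORE DESCENT from odd total rank by Čebotarev primes ((Cheb1) one class, (Cheb2) two classes of
opposite signs — tree `chebOne_of_mcCallum_P` ∕ `chebTwo_of_mcCallum_P`); §6 the SIGN of a core's generator (`ε₀ xor bodd #m`).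

HONEST FRAMING: linear algebra + combinatorics; 0 definitions, 0 named facts, 0 `sorry`; (Z) ∕ (Det) ∕ (Jump) ∕ (Line) ∕ (Cheb1) ∕ (Cheb2)
are HYPOTHESES; closes nothing. BSD is not proved by any of this; KS′ is not proved by any of this.

References: [cite: Howard2004HeegnerKolyvagin, §1.5–§1.6, Thm. 1.6.1] [cite: MazurRubin2004, Lemma 4.1.7, Thm. 4.4.1]
[cite: WZhang2014, §8.1 (8.1), Lemma 8.2] [cite: GrossLMS1991, Prop. 6.2, Prop. 8.1] [cite: McCallumLMS1991, Cor. 3.2, Lemma 5.3].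
-/

-- single-conjunct summit: `Summit.BirchSwinnertonDyer.BirchSwinnertonDyer.…` repeats the name by design
set_option linter.dupNamespace false

noncomputable section

open scoped Classical

namespace Summit.BirchSwinnertonDyer.BirchSwinnertonDyer.Theorems.AdditiveKoly.CanonicalLines

open Module
open Summit.BirchSwinnertonDyer.Rank1Residual.X11b.Three.Koly.CoreGraph

variable {F : Type*} [Field F] {H : Type*} [AddCommGroup H] [Module F H] {L : Type*} [DecidableEq L]
  (S : Finset L → Bool → Submodule F H) (Z : L → Submodule F H)

/-! ## §1 Codimension one from line-rigidity -/

omit [DecidableEq L] in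
/-- **Codimension one.** If `x ∈ A` lies off `Zl` and every class of `A` is proportional to `x` modulo `Zl`, then
`dim A = dim (A ⊓ Zl) + 1` (`A = (A ⊓ Zl) ⊕ F·x`). [folklore] -/
theorem finrank_eq_finrank_inf_add_one {A Zl : Submodule F H} [Module.Finite F A] {x : H} (hx : x ∈ A) (hxZ : x ∉ Zl)
    (hline : ∀ x' ∈ A, ∃ a : F, x' - a • x ∈ Zl) :
    finrank F A = finrank F (A ⊓ Zl : Submodule F H) + 1 := by
  have hx0 : x ≠ 0 := fun h ↦ hxZ (h ▸ Zl.zero_mem)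
  have hsup : (A ⊓ Zl) ⊔ (F ∙ x) = A := by
    refine le_antisymm (sup_le inf_le_left ((Submodule.span_singleton_le_iff_mem x A).mpr hx)) fun x' hx' ↦ ?_
    obtain ⟨a, ha⟩ := hline x' hx'
    have hmem : x' - a • x ∈ A ⊓ Zl := ⟨A.sub_mem hx' (A.smul_mem a hx), ha⟩
    have hax : a • x ∈ F ∙ x := Submodule.smul_mem _ a (Submodule.mem_span_singleton_self x)
    have : x' = (x' - a • x) + a • x := by abel
    rw [this]
    exact Submodule.add_mem_sup hmem hax
  have hinf : (A ⊓ Zl) ⊓ (F ∙ x) = ⊥ := by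
    refine (Submodule.eq_bot_iff _).mpr fun y hy ↦ ?_
    obtain ⟨⟨-, hyZ⟩, hyx⟩ := hy
    obtain ⟨b, rfl⟩ := Submodule.mem_span_singleton.mp hyx
    by_cases hb : b = 0
    · rw [hb, zero_smul]
    · exact absurd (by simpa only [inv_smul_smul₀ hb] using Zl.smul_mem b⁻¹ hyZ) hxZ
  have h := Submodule.finrank_sup_add_finrank_inf_eq (A ⊓ Zl) (F ∙ x)
  rw [hsup, hinf, finrank_bot, finrank_span_singleton hx0, add_zero] at h
  exact h

/-! ## §2 The twin dichotomy for the ranks; parities -/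

-- the twin-dichotomy hypotheses (Z) (Det) (Jump) (Line) and finite-dimensionality, shared by §§2–6
variable (hZ : ∀ (m : Finset L) (ℓ : L) (μ : Bool), ℓ ∉ m → S (insert ℓ m) μ ⊓ Z ℓ = S m μ ⊓ Z ℓ)
  (hDet : ∀ (m : Finset L) (ℓ : L) (μ : Bool), ℓ ∉ m → (∃ x ∈ S m μ, x ∉ Z ℓ) → S (insert ℓ m) μ ≤ Z ℓ)
  (hJump : ∀ (m : Finset L) (ℓ : L) (μ : Bool), ℓ ∉ m → S m μ ≤ Z ℓ → ∃ y ∈ S (insert ℓ m) μ, y ∉ Z ℓ)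
  (hLine : ∀ (m : Finset L) (ℓ : L) (μ : Bool), ∀ x ∈ S m μ, x ∉ Z ℓ → ∀ x' ∈ S m μ, ∃ a : F, x' - a • x ∈ Z ℓ)
  (hfin : ∀ (m : Finset L) (μ : Bool), Module.Finite F (S m μ))

include hZ hDet in
/-- **Detected ⟹ strict.** If some `μ`-class of conductor `m` is detected above the new Kolyvagin prime `ℓ`, the `μ`-space of
conductor `mℓ` is the subspace of `S(m)^μ` vanishing above `ℓ`. [cite: MazurRubin2004, Lemma 4.1.7] [cite: Howard2004HeegnerKolyvagin, §1.6] -/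
theorem eq_inf_of_detected {m : Finset L} {ℓ : L} {μ : Bool} (hℓ : ℓ ∉ m) (hx : ∃ x ∈ S m μ, x ∉ Z ℓ) :
    S (insert ℓ m) μ = S m μ ⊓ Z ℓ := by
  rw [← hZ m ℓ μ hℓ]
  exact (inf_eq_left.mpr (hDet m ℓ μ hℓ hx)).symm

include hZ in
/-- **Undetected ⟹ the old space is the strict part of the new one.** [cite: MazurRubin2004, Lemma 4.1.7] -/
theorem eq_inf_of_undetected {m : Finset L} {ℓ : L} {μ : Bool} (hℓ : ℓ ∉ m) (hle : S m μ ≤ Z ℓ) :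
    S m μ = S (insert ℓ m) μ ⊓ Z ℓ := by
  rw [hZ m ℓ μ hℓ]
  exact (inf_eq_left.mpr hle).symm

include hZ hDet hLine hfin in
/-- **Twin dichotomy, LOWERING branch**: a detected sign DROPS by exactly one at `mℓ`.
[cite: MazurRubin2004, Lemma 4.1.7] [cite: Howard2004HeegnerKolyvagin, Thm. 1.6.1] -/
theorem finrank_insert_of_detected {m : Finset L} {ℓ : L} {μ : Bool} (hℓ : ℓ ∉ m)
    (hx : ∃ x ∈ S m μ, x ∉ Z ℓ) :
    finrank F (S (insert ℓ m) μ) + 1 = finrank F (S m μ) := by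
  haveI := hfin m μ
  rw [eq_inf_of_detected S Z hZ hDet hℓ hx]
  obtain ⟨x, hxS, hxZ⟩ := hx
  exact (finrank_eq_finrank_inf_add_one hxS hxZ (hLine m ℓ μ x hxS hxZ)).symm

include hZ hJump hLine hfin in
/-- **Twin dichotomy, RAISING branch**: an undetected sign RISES by exactly one at `mℓ`.
[cite: MazurRubin2004, Lemma 4.1.7] [cite: Howard2004HeegnerKolyvagin, Thm. 1.6.1] -/
theorem finrank_insert_of_undetected {m : Finset L} {ℓ : L} {μ : Bool} (hℓ : ℓ ∉ m)
    (hle : S m μ ≤ Z ℓ) :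
    finrank F (S (insert ℓ m) μ) = finrank F (S m μ) + 1 := by
  haveI := hfin (insert ℓ m) μ
  obtain ⟨y, hyS, hyZ⟩ := hJump m ℓ μ hℓ hle
  rw [eq_inf_of_undetected S Z hZ hℓ hle]
  exact finrank_eq_finrank_inf_add_one hyS hyZ (hLine (insert ℓ m) ℓ μ y hyS hyZ)

include hZ hDet hJump hLine hfin in
/-- **Each sign flips parity with every new Kolyvagin prime**: `dim S(mℓ)^μ + dim S(m)^μ` is odd.
[cite: Howard2004HeegnerKolyvagin, Thm. 1.6.1] -/
theorem odd_finrank_insert_add {m : Finset L} {ℓ : L} (μ : Bool) (hℓ : ℓ ∉ m) :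
    Odd (finrank F (S (insert ℓ m) μ) + finrank F (S m μ)) := by
  by_cases hx : ∃ x ∈ S m μ, x ∉ Z ℓ
  · rw [← finrank_insert_of_detected S Z hZ hDet hLine hfin hℓ hx]
    exact ⟨finrank F (S (insert ℓ m) μ), by ring⟩
  · push Not at hx
    rw [finrank_insert_of_undetected S Z hZ hJump hLine hfin hℓ hx]
    exact ⟨finrank F (S m μ), by ring⟩

include hZ hDet hJump hLine hfin in
/-- **Sign parity along the conductor**: `dim S(m)^μ ≡ dim S(∅)^μ + #m (mod 2)`.
[cite: Howard2004HeegnerKolyvagin, Thm. 1.6.1] [cite: MazurRubin2004, Thm. 4.4.1] -/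
theorem even_finrank_iff_even_card (μ : Bool) (m : Finset L) :
    (Even (finrank F (S m μ)) ↔ Even (finrank F (S ∅ μ))) ↔ Even m.card := by
  induction m using Finset.induction_on with
  | empty => simp
  | insert ℓ m hℓ ih =>
    have hodd := odd_finrank_insert_add S Z hZ hDet hJump hLine hfin μ hℓ
    rw [Finset.card_insert_of_notMem hℓ, Nat.even_add_one, ← ih]
    rw [← Nat.not_even_iff_odd, Nat.even_add] at hodd
    tauto

include hZ hDet hJump hLine hfin in
/-- **The TOTAL parity is constant along the conductor** (each Kolyvagin prime flips BOTH signs).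
[cite: Howard2004HeegnerKolyvagin, Thm. 1.6.1] -/
theorem even_total_iff (m : Finset L) :
    Even (finrank F (S m true) + finrank F (S m false)) ↔ Even (finrank F (S ∅ true) + finrank F (S ∅ false)) := by
  have ht := even_finrank_iff_even_card S Z hZ hDet hJump hLine hfin true m
  have hf := even_finrank_iff_even_card S Z hZ hDet hJump hLine hfin false m
  rw [Nat.even_add, Nat.even_add]
  tauto


/-! ## §3 Cores: total rank one -/

include hfin in
omit [DecidableEq L] in
/-- At a core (total rank one) a non-zero class spans its sign and the other sign is zero. [folklore] -/
theorem finrank_eq_one_of_total_eq_one {m : Finset L}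
    (h1 : finrank F (S m true) + finrank F (S m false) = 1) {μ : Bool} {x : H} (hx : x ∈ S m μ) (hx0 : x ≠ 0) :
    finrank F (S m μ) = 1 ∧ finrank F (S m (!μ)) = 0 := by
  haveI := hfin m μ
  have hpos : finrank F (S m μ) ≠ 0 := by
    intro h0
    rw [Submodule.finrank_eq_zero] at h0
    rw [h0] at hx
    exact hx0 ((Submodule.mem_bot F).mp hx)
  have htot := finrank_add_finrank_not S m μ
  omega

include hfin in
omit [DecidableEq L] in
/-- At a core, every class of the non-zero sign is a multiple of any non-zero class of that sign. [folklore] -/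
theorem exists_smul_eq_of_total_eq_one {m : Finset L}
    (h1 : finrank F (S m true) + finrank F (S m false) = 1) {μ : Bool} {x : H} (hx : x ∈ S m μ) (hx0 : x ≠ 0)
    {y : H} (hy : y ∈ S m μ) : ∃ a : F, a • x = y := by
  haveI := hfin m μ
  have h := (finrank_eq_one_of_total_eq_one S hfin h1 hx hx0).1
  have hx0' : (⟨x, hx⟩ : S m μ) ≠ 0 := fun h' ↦ hx0 (congrArg Subtype.val h')
  obtain ⟨a, ha⟩ := (finrank_eq_one_iff_of_nonzero' (⟨x, hx⟩ : S m μ) hx0').mp h ⟨y, hy⟩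
  exact ⟨a, congrArg Subtype.val ha⟩

include hfin in
omit [DecidableEq L] in
/-- At a core, a class of the OTHER sign than a non-zero class is zero. [folklore] -/
theorem eq_zero_of_total_eq_one_of_mem_not {m : Finset L}
    (h1 : finrank F (S m true) + finrank F (S m false) = 1) {μ : Bool} {x : H} (hx : x ∈ S m μ) (hx0 : x ≠ 0)
    {y : H} (hy : y ∈ S m (!μ)) : y = 0 := by
  haveI := hfin m (!μ)
  have h := (finrank_eq_one_of_total_eq_one S hfin h1 hx hx0).2
  rw [Submodule.finrank_eq_zero] at h
  rw [h] at hy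
  exact (Submodule.mem_bot F).mp hy

include hfin in
omit [DecidableEq L] in
/-- **Canonical lines exist**: a function `κ` on conductors which is a non-zero class of one sign at every core and `0` at every
non-core. [cite: MazurRubin2004, Thm. 4.4.1] [cite: Howard2004HeegnerKolyvagin, Thm. 1.6.1] -/
theorem exists_canonicalLines :
    ∃ κ : Finset L → H,
      (∀ m, finrank F (S m true) + finrank F (S m false) = 1 → ∃ μ, κ m ∈ S m μ ∧ κ m ≠ 0) ∧
      (∀ m, finrank F (S m true) + finrank F (S m false) ≠ 1 → κ m = 0) := by
  refine ⟨fun m ↦ if h : finrank F (S m true) + finrank F (S m false) = 1 then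
      Classical.choose (Classical.choose_spec (exists_generator_of_total_eq_one S hfin h)) else 0, ?_, ?_⟩
  · intro m h1
    have hspec := Classical.choose_spec (Classical.choose_spec (exists_generator_of_total_eq_one S hfin h1))
    refine ⟨Classical.choose (exists_generator_of_total_eq_one S hfin h1), ?_, ?_⟩
    · simp only [dif_pos h1]; exact hspec.2.2.1
    · simp only [dif_pos h1]; exact hspec.2.2.2.1
  · intro m h1
    simp only [dif_neg h1]

/-! ## §4 The relation (8.1) for canonical lines -/

variable {κ : Finset L → H}
  (hκ1 : ∀ m, finrank F (S m true) + finrank F (S m false) = 1 → ∃ μ, κ m ∈ S m μ ∧ κ m ≠ 0)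
  (hκ0 : ∀ m, finrank F (S m true) + finrank F (S m false) ≠ 1 → κ m = 0)

include hZ hDet hJump hLine hfin hκ1 in
/-- **A core whose line is detected above `ℓ` is followed by a core at `mℓ` whose line is detected above `ℓ`** (the core–core
edge of Howard's graph in the conductor direction: `(1,0) ↦ (0,1)`). [cite: Howard2004HeegnerKolyvagin, Thm. 1.6.1]
[cite: MazurRubin2004, Thm. 4.4.1] -/
theorem not_mem_insert_of_core_of_not_mem {m : Finset L} {ℓ : L} (hℓ : ℓ ∉ m)
    (h1 : finrank F (S m true) + finrank F (S m false) = 1) (hκ : κ m ∉ Z ℓ) : κ (insert ℓ m) ∉ Z ℓ := by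
  obtain ⟨μ, hκS, hκ0'⟩ := hκ1 m h1
  have hrk := finrank_eq_one_of_total_eq_one S hfin h1 hκS hκ0'
  have hdμ : finrank F (S (insert ℓ m) μ) = 0 := by
    have h := finrank_insert_of_detected S Z hZ hDet hLine hfin hℓ ⟨κ m, hκS, hκ⟩
    omega
  have hle : S m (!μ) ≤ Z ℓ := fun y hy ↦ by
    rw [eq_zero_of_total_eq_one_of_mem_not S hfin h1 hκS hκ0' hy]; exact (Z ℓ).zero_mem
  have huμ : finrank F (S (insert ℓ m) (!μ)) = 1 := by
    rw [finrank_insert_of_undetected S Z hZ hJump hLine hfin hℓ hle, hrk.2]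
  have h1' : finrank F (S (insert ℓ m) true) + finrank F (S (insert ℓ m) false) = 1 := by
    rw [← finrank_add_finrank_not S (insert ℓ m) μ]; omega
  obtain ⟨ν, hνS, hν0⟩ := hκ1 (insert ℓ m) h1'
  have hν : ν = !μ := by
    haveI := hfin (insert ℓ m) μ
    by_contra hne
    have hνμ : ν = μ := by cases ν <;> cases μ <;> simp_all
    rw [hνμ, Submodule.finrank_eq_zero.mp hdμ] at hνS
    exact hν0 ((Submodule.mem_bot F).mp hνS)
  subst hν
  intro hmem
  obtain ⟨y, hyS, hyZ⟩ := hJump m ℓ (!μ) hℓ hle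
  obtain ⟨a, rfl⟩ := exists_smul_eq_of_total_eq_one S hfin h1' hνS hν0 hyS
  exact hyZ ((Z ℓ).smul_mem a hmem)

include hZ hDet hJump hLine hfin hκ1 hκ0 in
/-- **The relation (8.1) for canonical lines**: above a new Kolyvagin prime `ℓ ∉ m`, `κ(mℓ)` vanishes iff `κ(m)` does.
Cases: `m` a core detected above `ℓ` — then `mℓ` is a core detected above `ℓ` (`not_mem_insert_of_core_of_not_mem`); `m` a core
NOT detected — then `mℓ` has total rank `3` and `κ(mℓ) = 0`; `m` not a core — then `κ(m) = 0`, and `κ(mℓ)` vanishes above `ℓ`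
since a core at `mℓ` detected above `ℓ` forces, by the rank count in both signs, a core at `m`.
[cite: WZhang2014, §8.1 (8.1)] [cite: GrossLMS1991, Prop. 6.2] [cite: Howard2004HeegnerKolyvagin, Thm. 1.6.1] -/
theorem mem_iff_mem_of_canonicalLines {m : Finset L} {ℓ : L} (hℓ : ℓ ∉ m) :
    κ (insert ℓ m) ∈ Z ℓ ↔ κ m ∈ Z ℓ := by
  by_cases h1 : finrank F (S m true) + finrank F (S m false) = 1
  · by_cases hκ : κ m ∈ Z ℓ
    · -- core, undetected in its sign: the rank rises to 2, total 3, κ(mℓ) = 0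
      refine iff_of_true ?_ hκ
      obtain ⟨μ, hκS, hκ0'⟩ := hκ1 m h1
      have hrk := finrank_eq_one_of_total_eq_one S hfin h1 hκS hκ0'
      have hleμ : S m μ ≤ Z ℓ := fun y hy ↦ by
        obtain ⟨a, rfl⟩ := exists_smul_eq_of_total_eq_one S hfin h1 hκS hκ0' hy
        exact (Z ℓ).smul_mem a hκ
      have hle' : S m (!μ) ≤ Z ℓ := fun y hy ↦ by
        rw [eq_zero_of_total_eq_one_of_mem_not S hfin h1 hκS hκ0' hy]; exact (Z ℓ).zero_mem
      have huμ := finrank_insert_of_undetected S Z hZ hJump hLine hfin hℓ hleμ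
      have hu' := finrank_insert_of_undetected S Z hZ hJump hLine hfin hℓ hle'
      have h3 : finrank F (S (insert ℓ m) true) + finrank F (S (insert ℓ m) false) ≠ 1 := by
        rw [← finrank_add_finrank_not S (insert ℓ m) μ]; omega
      rw [hκ0 _ h3]
      exact (Z ℓ).zero_mem
    · exact iff_of_false (not_mem_insert_of_core_of_not_mem S Z hZ hDet hJump hLine hfin hκ1 hℓ h1 hκ) hκ
  · -- not a core: κ(m) = 0; a core at mℓ detected above ℓ would force a core at m
    rw [hκ0 m h1]
    refine iff_of_true ?_ (Z ℓ).zero_mem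
    by_cases h1' : finrank F (S (insert ℓ m) true) + finrank F (S (insert ℓ m) false) = 1
    · by_contra hmem
      obtain ⟨ν, hνS, hν0⟩ := hκ1 (insert ℓ m) h1'
      have hrk := finrank_eq_one_of_total_eq_one S hfin h1' hνS hν0
      -- sign ν at m is undetected (else S(mℓ)^ν ≤ Z ℓ ∋ κ(mℓ)), so it rose: dim S(m)^ν = 0
      have hud : S m ν ≤ Z ℓ := by
        by_contra hx
        obtain ⟨x, hxS, hxZ⟩ : ∃ x ∈ S m ν, x ∉ Z ℓ := by
          by_contra h; push Not at h; exact hx h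
        exact hmem (hDet m ℓ ν hℓ ⟨x, hxS, hxZ⟩ hνS)
      have hν0' : finrank F (S m ν) = 0 := by
        have h := finrank_insert_of_undetected S Z hZ hJump hLine hfin hℓ hud
        omega
      -- sign ¬ν at mℓ is 0, so at m it was detected (a rise would give ≥ 1): dim S(m)^{¬ν} = 1
      have hν1' : finrank F (S m (!ν)) = 1 := by
        by_cases hx : ∃ x ∈ S m (!ν), x ∉ Z ℓ
        · have h := finrank_insert_of_detected S Z hZ hDet hLine hfin hℓ hx
          omega
        · push Not at hx
          have h := finrank_insert_of_undetected S Z hZ hJump hLine hfin hℓ hx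
          omega
      exact h1 (by rw [← finrank_add_finrank_not S m ν]; omega)
    · rw [hκ0 _ h1']
      exact (Z ℓ).zero_mem


/-! ## §5 Core descent in the conductor direction -/

variable (hCheb1 : ∀ (m : Finset L) (μ : Bool), ∀ x ∈ S m μ, x ≠ 0 → ∃ ℓ, ℓ ∉ m ∧ x ∉ Z ℓ)
  (hCheb2 : ∀ (m : Finset L), ∀ x ∈ S m true, ∀ y ∈ S m false, x ≠ 0 → y ≠ 0 → ∃ ℓ, ℓ ∉ m ∧ x ∉ Z ℓ ∧ y ∉ Z ℓ)

include hZ hDet hLine hfin hCheb2 in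
/-- **Two-sign step**: if both signs are non-zero at `m`, a Čebotarev prime detecting one class of each sign lowers the total rank
by two. [cite: McCallumLMS1991, Cor. 3.2] [cite: Howard2004HeegnerKolyvagin, §1.6] -/
theorem exists_insert_total_add_two {m : Finset L} (ht : 0 < finrank F (S m true))
    (hf : 0 < finrank F (S m false)) :
    ∃ ℓ, ℓ ∉ m ∧ finrank F (S (insert ℓ m) true) + finrank F (S (insert ℓ m) false) + 2 =
      finrank F (S m true) + finrank F (S m false) := by
  obtain ⟨x, hx, hx0⟩ := exists_mem_ne_zero_of_finrank_pos' ht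
  obtain ⟨y, hy, hy0⟩ := exists_mem_ne_zero_of_finrank_pos' hf
  obtain ⟨ℓ, hℓ, hxZ, hyZ⟩ := hCheb2 m x hx y hy hx0 hy0
  have h₁ := finrank_insert_of_detected S Z hZ hDet hLine hfin hℓ ⟨x, hx, hxZ⟩
  have h₂ := finrank_insert_of_detected S Z hZ hDet hLine hfin hℓ ⟨y, hy, hyZ⟩
  exact ⟨ℓ, hℓ, by omega⟩

include hZ hDet hJump hLine hfin hCheb1 in
/-- **One-sign step**: if exactly the sign `μ` is non-zero at `m`, a Čebotarev prime detecting a `μ`-class moves the ranks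
`(a, 0) ↦ (a − 1, 1)` (total unchanged, both signs now non-zero when `a ≥ 2`). [cite: McCallumLMS1991, Cor. 3.2]
[cite: Howard2004HeegnerKolyvagin, §1.6] -/
theorem exists_insert_of_one_sign {m : Finset L} {μ : Bool} (hμ : 0 < finrank F (S m μ))
    (hμ' : finrank F (S m (!μ)) = 0) :
    ∃ ℓ, ℓ ∉ m ∧ finrank F (S (insert ℓ m) μ) + 1 = finrank F (S m μ) ∧ finrank F (S (insert ℓ m) (!μ)) = 1 := by
  haveI := hfin m (!μ)
  obtain ⟨x, hx, hx0⟩ := exists_mem_ne_zero_of_finrank_pos' hμ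
  obtain ⟨ℓ, hℓ, hxZ⟩ := hCheb1 m μ x hx hx0
  have hle : S m (!μ) ≤ Z ℓ := by
    rw [Submodule.finrank_eq_zero.mp hμ']; exact bot_le
  exact ⟨ℓ, hℓ, finrank_insert_of_detected S Z hZ hDet hLine hfin hℓ ⟨x, hx, hxZ⟩,
    by rw [finrank_insert_of_undetected S Z hZ hJump hLine hfin hℓ hle, hμ']⟩

include hZ hDet hJump hLine hfin hCheb1 hCheb2 in
/-- **Core descent in the conductor direction**: above a conductor of ODD total rank there is a CORE (total rank one) — while the
total rank is `≥ 3`: if both signs are non-zero lower both (total `−2`); if one sign is zero, first move `(a,0) ↦ (a−1,1)`, then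
lower both. [cite: MazurRubin2004, §4.1, Thm. 4.4.1] [cite: Howard2004HeegnerKolyvagin, Thm. 1.6.1] [cite: McCallumLMS1991, Cor. 3.2] -/
theorem exists_core_superset_of_odd {m₀ : Finset L}
    (hodd : Odd (finrank F (S m₀ true) + finrank F (S m₀ false))) :
    ∃ m : Finset L, m₀ ⊆ m ∧ finrank F (S m true) + finrank F (S m false) = 1 := by
  suffices H : ∀ (k : ℕ) (m : Finset L), finrank F (S m true) + finrank F (S m false) = k → Odd k →
      ∃ n : Finset L, m ⊆ n ∧ finrank F (S n true) + finrank F (S n false) = 1 from H _ m₀ rfl hodd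
  intro k
  induction k using Nat.strong_induction_on with
  | _ k ih =>
    intro m hk hko
    by_cases h1 : k = 1
    · exact ⟨m, Finset.Subset.refl m, hk.trans h1⟩
    · have hk3 : 3 ≤ k := by
        obtain ⟨j, rfl⟩ := hko
        omega
      -- reach a conductor m₁ ⊇ m of total rank k with both signs non-zero
      obtain ⟨m₁, hmm₁, hk₁, ht₁, hf₁⟩ : ∃ m₁ : Finset L, m ⊆ m₁ ∧
          finrank F (S m₁ true) + finrank F (S m₁ false) = k ∧ 0 < finrank F (S m₁ true) ∧ 0 < finrank F (S m₁ false) := by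
        by_cases ht : 0 < finrank F (S m true)
        · by_cases hf : 0 < finrank F (S m false)
          · exact ⟨m, Finset.Subset.refl m, hk, ht, hf⟩
          · have hf0 : finrank F (S m (!true)) = 0 := by change finrank F (S m false) = 0; omega
            obtain ⟨ℓ, hℓ, hd, hu⟩ := exists_insert_of_one_sign S Z hZ hDet hJump hLine hfin hCheb1 ht hf0
            change finrank F (S (insert ℓ m) false) = 1 at hu
            exact ⟨insert ℓ m, Finset.subset_insert ℓ m, by omega, by omega, by omega⟩
        · have ht0 : finrank F (S m (!false)) = 0 := by change finrank F (S m true) = 0; omega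
          have hf : 0 < finrank F (S m false) := by omega
          obtain ⟨ℓ, hℓ, hd, hu⟩ := exists_insert_of_one_sign S Z hZ hDet hJump hLine hfin hCheb1 hf ht0
          change finrank F (S (insert ℓ m) true) = 1 at hu
          exact ⟨insert ℓ m, Finset.subset_insert ℓ m, by omega, by omega, by omega⟩
      obtain ⟨ℓ, hℓ, h2⟩ := exists_insert_total_add_two S Z hZ hDet hLine hfin hCheb2 ht₁ hf₁
      obtain ⟨n, hmn, hn⟩ := ih (k - 2) (by omega) (insert ℓ m₁) (by omega) (by
        obtain ⟨j, rfl⟩ := hko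
        exact ⟨j - 1, by omega⟩)
      exact ⟨n, (hmm₁.trans (Finset.subset_insert ℓ m₁)).trans hmn, hn⟩


/-! ## §6 The sign of a core's generator -/

include hZ hDet hJump hLine hfin in
/-- **The sign of the canonical line at a core** `m` with a non-zero class of sign `μ`: the rank of sign `μ` at conductor `∅` is ODD
iff `#m` is even — i.e. `μ = ε₀ xor bodd #m` with `ε₀` the odd-rank sign at `∅` (the crux's `sign` row).
[cite: WZhang2014, §8.1 property (1)] [cite: Howard2004HeegnerKolyvagin, Thm. 1.6.1] -/
theorem odd_finrank_empty_iff_even_card_of_core {m : Finset L} (h1 : finrank F (S m true) + finrank F (S m false) = 1) {μ : Bool} {x : H} (hx : x ∈ S m μ)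
    (hx0 : x ≠ 0) : Odd (finrank F (S ∅ μ)) ↔ Even m.card := by
  have hrk := (finrank_eq_one_of_total_eq_one S hfin h1 hx hx0).1
  have h := even_finrank_iff_even_card S Z hZ hDet hJump hLine hfin μ m
  rw [hrk] at h
  rw [← Nat.not_even_iff_odd]
  have h1odd : ¬ Even 1 := Nat.not_even_one
  tauto

end Summit.BirchSwinnertonDyer.BirchSwinnertonDyer.Theorems.AdditiveKoly.CanonicalLines

end
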